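import Summits.QuantumAdvantage.QuantumAdvantage.Theorems.CubicForrelationNearExactIsExactSixteenSplitPrep
import Summits.QuantumAdvantage.QuantumAdvantage.Theorems.CubicForrelationNearExactIsExactSixteenSplitBudget

/-!
# Crux `CubicForrelation.NearExactIsExact` (stmt-QuantumAdvantage-14043) — n = 16, TWO-SIDED: the split configuration (sA) is not realizable

Certificate seat `b2b-cforr-cert` (gen 6).  HONEST FRAMING: a theorem about cubic Boolean pairs on 16 bits (finite slice `n = 16` of the crux) —
one of the three split boundary configurations of `Φ = 31/32` (`sb_split_trichotomy`) is excluded; NOT summit progress.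

Configuration (sA): `W_g = 64u`, `d₀ = [u odd]` non-constant affine (`L`/`H`), digit sets `B = C = ∅` and `A = {u even, d₁ = 1} ⊂ H` with `2¹³`
points; the residual `τ = u − 4(−1)^f` is `(−1)^{d₁}` on `L`, `±2` on `A`, `0` on `H ∖ A`.
* `A` is the support of the degree-`≤ 3` function `¬d₀ ∧ d₁` with `2¹³` ones: a 13-flat `x_A ⊕ V_A` (`mw_flat_of_minweight`); `V_A` consists of
  periods of `d₀` (affine) and `d₁(h ⊕ a) = d₁(h)` on `H` for `a ∈ V_A`, so the `L`-piece `(−1)^{d₁}1_L` has all of `V_A` as periods up to sign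
  (`sp_L_l1`): `Σ|·̂| ≤ 2¹⁷`.
* The `A`-piece `ε = τ/2 = ±1` on `A`: two directions `t₁, t₂ ∈ V_L` transversal to `V_A` (`fl1_dirs2`, `2·2¹³ < 2¹⁵`) move `A` inside `H ∖ A`
  where `τ = 0`, so the general 5- and 6-flat sums give (H3)/(H4) (`sp_H34`) and the engine `fl1_flat_l1` (rank `≤ 2` along the flat) gives
  `Σ|(ε1_A)^| ≤ 2¹⁷`.
* Pairing (`sl_pairing16`): `2²¹ = Σ_y (−1)^g τ̂(y) ≤ 2¹⁷ + 2·2¹⁷`. Contradiction (`sa_splitA_false`).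

References: J. Ax (1964) / R. J. McEliece (1972); MacWilliams–Sloane (1977) Ch. 13–15; R. O'Donnell (2014) §3.3.  Everything below is proved
from Mathlib and the tree; axioms are the standard three.
-/

set_option linter.dupNamespace false -- D-0017: single-problem summit ⇒ `QuantumAdvantage.QuantumAdvantage` by design

noncomputable section

namespace Summit.QuantumAdvantage.QuantumAdvantage.Theorems.CubicForrelation.NearExactIsExact

open Finset
open Literature.Computability.QuantumComplexity
open Literature.Computability.QuantumComplexity.BuzetChailloux (bxor zeroVec bxor_bxor_cancel_left bxor_zeroVec zeroVec_bxor bxor_comm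
  bxor_self)
open Literature.Computability.QuantumComplexity.DerivativeWalsh (W)

/-- **Configuration (sA) is empty.**  For cubic `f, g : 𝔽₂¹⁶ → 𝔽₂` with `W_g = 64u`, a non-constant parity `[u odd]`, `Φ(f,g) = 31/32`, the
pointwise budget identity of `sb_split_trichotomy`, and digit sets `#A = 2¹³`, `B = C = ∅`: contradiction. [this work] -/
theorem sa_splitA_false (f g : (Fin (8 + 8) → Bool) → Bool) (hf : IsDegLeFun 3 f) (hg : IsDegLeFun 3 g)
    (u : (Fin (8 + 8) → Bool) → ℤ) (hu : ∀ x, W (fun y => signOf (g y)) x = (2 : ℝ) ^ 6 * (u x : ℝ))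
    (hodd : ∃ x, Odd (u x)) (heven : ∃ x, ¬ Odd (u x)) (hΦ : forrelation f g = 31 / 32)
    (hpt : ∀ x, (u x - 4 * sZ (f x)) ^ 2 = (if Odd (u x) then 1 else 0) + 4 * (if ¬ Odd (u x) ∧ Odd (u x / 2) then 1 else 0)
      + 16 * (if ¬ Odd (u x) ∧ ¬ Odd (u x / 2) ∧ ¬ Odd (u x / 2 / 2) then 1 else 0)
      + 8 * (if Odd (u x) ∧ (Odd (u x / 2) ↔ Odd (u x / 2 / 2)) then 1 else 0))
    (hAc : #(univ.filter fun x : Fin (8 + 8) → Bool => ¬ Odd (u x) ∧ Odd (u x / 2)) = 2 ^ 13)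
    (hB0 : #(univ.filter fun x : Fin (8 + 8) → Bool => ¬ Odd (u x) ∧ ¬ Odd (u x / 2) ∧ ¬ Odd (u x / 2 / 2)) = 0)
    (hC0 : #(univ.filter fun x : Fin (8 + 8) → Bool => Odd (u x) ∧ (Odd (u x / 2) ↔ Odd (u x / 2 / 2))) = 0) : False := by
  classical
  -- digits
  have hd0 : IsDegLeFun 1 (fun x => decide (Odd (u x))) := sx_digitZero g u hg hu
  have hd1 : IsDegLeFun 2 (fun x => decide (Odd (u x / 2))) := sx_digitOne g u hg hu
  have hB : ∀ x, ¬ Odd (u x) → ¬ Odd (u x / 2) → Odd (u x / 2 / 2) := by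
    intro x hx h2
    by_contra h3
    exact filter_eq_empty_iff.1 (card_eq_zero.1 hB0) (mem_univ x) ⟨hx, h2, h3⟩
  have hC : ∀ x, Odd (u x) → ¬ (Odd (u x / 2) ↔ Odd (u x / 2 / 2)) := by
    intro x hx h
    exact filter_eq_empty_iff.1 (card_eq_zero.1 hC0) (mem_univ x) ⟨hx, h⟩
  set A := univ.filter (fun x : Fin (8 + 8) → Bool => ¬ Odd (u x) ∧ Odd (u x / 2)) with hAdef
  have hmemA : ∀ x, x ∈ A ↔ ¬ Odd (u x) ∧ Odd (u x / 2) := fun x => by simp [hAdef]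
  -- the residual
  have hτL : ∀ x, Odd (u x) → u x - 4 * sZ (f x) = sZ (decide (Odd (u x / 2))) := by
    intro x hx
    have h := hpt x
    rw [if_pos hx, if_neg (fun h => h.1 hx), if_neg (fun h => h.1 hx), if_neg (fun h => hC x hx h.2)] at h
    have h1 : (u x - 4 * sZ (f x)) * (u x - 4 * sZ (f x)) = 1 := by rw [← pow_two]; linarith
    exact sp_tau_one (mul_self_eq_one_iff.1 h1)
  have hτA : ∀ x, x ∈ A → (u x - 4 * sZ (f x)) ^ 2 = 4 := by
    intro x hxA
    have hx := (hmemA x).1 hxA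
    have h := hpt x
    rw [if_neg hx.1, if_pos hx, if_neg (fun h => h.2.1 hx.2), if_neg (fun h => hx.1 h.1)] at h
    linarith
  have hτ0 : ∀ x, ¬ Odd (u x) → x ∉ A → u x - 4 * sZ (f x) = 0 := by
    intro x hx hxA
    have h2 : ¬ Odd (u x / 2) := fun h => hxA ((hmemA x).2 ⟨hx, h⟩)
    have h := hpt x
    rw [if_neg hx, if_neg (fun h => hxA ((hmemA x).2 h)), if_neg (fun h => h.2.2 (hB x hx h2)), if_neg (fun h => hx h.1)] at h
    have h' : (u x - 4 * sZ (f x)) ^ 2 = 0 := by linarith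
    exact (pow_eq_zero_iff two_ne_zero).1 h'
  -- `A` is a 13-flat
  have hdegA : IsDegLeFun (2 + 1) (fun x => (decide (Odd (u x)) ^^ true) && decide (Odd (u x / 2))) :=
    bb_deg_and (tb_isDegLeFun_xor_const hd0 true) hd1 (by norm_num)
  have hsetA : (univ.filter fun x : Fin (8 + 8) → Bool => ((decide (Odd (u x)) ^^ true) && decide (Odd (u x / 2))) = true) = A :=
    by rw [hAdef]; exact filter_congr fun x _ => by simp
  have hmwA := mw_flat_of_minweight 2 _ hdegA (by rw [hsetA, hAc]; norm_num)
  rw [hsetA] at hmwA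
  obtain ⟨h0A, haddA, hcardVA, hcosetA⟩ := hmwA
  set VA := univ.filter (fun a : Fin (8 + 8) → Bool => ∀ x,
    ((decide (Odd (u (bxor x a))) ^^ true) && decide (Odd (u (bxor x a) / 2))) =
      ((decide (Odd (u x)) ^^ true) && decide (Odd (u x / 2)))) with hVA
  rw [hAc] at hcardVA
  obtain ⟨xA, hxA⟩ : A.Nonempty := by rw [← card_pos, hAc]; norm_num
  have hSA : A = VA.image (bxor xA) := hcosetA xA (by have h := (hmemA xA).1 hxA; simp [h.1, h.2])
  have hperAfun : ∀ a ∈ VA, ∀ x, ((decide (Odd (u (bxor x a))) ^^ true) && decide (Odd (u (bxor x a) / 2))) =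
      ((decide (Odd (u x)) ^^ true) && decide (Odd (u x / 2))) := fun a ha => (mem_filter.1 ha).2
  -- `L` : periods of `d₀`
  have hfiltL : (univ.filter fun x : Fin (8 + 8) → Bool => decide (Odd (u x)) = true) = univ.filter fun x => Odd (u x) :=
    filter_congr fun x _ => by simp
  have hL15 : #(univ.filter fun x : Fin (8 + 8) → Bool => Odd (u x)) = 2 ^ 15 := sx_card_odd_of_split g u hg hu hodd heven
  have hd0' : IsDegLeFun (0 + 1) (fun x => decide (Odd (u x))) := hd0
  have hmwL := mw_flat_of_minweight 0 _ hd0' (by rw [hfiltL, hL15]; norm_num)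
  obtain ⟨h0L, haddL, hcardVL, -⟩ := hmwL
  rw [hfiltL, hL15] at hcardVL
  set VL := univ.filter (fun a : Fin (8 + 8) → Bool => ∀ x, decide (Odd (u (bxor x a))) = decide (Odd (u x))) with hVL
  have hperL : ∀ a ∈ VL, ∀ x, decide (Odd (u (bxor x a))) = decide (Odd (u x)) := fun a ha => (mem_filter.1 ha).2
  -- `V_A ⊆ V_L` (affine `d₀`, `A ⊂ H`)
  have hVAL : ∀ a ∈ VA, ∀ x, decide (Odd (u (bxor x a))) = decide (Odd (u x)) := by
    intro a ha x
    have hxa : bxor xA a ∈ A := fl1_coset_vadd haddA hSA hxA ha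
    have hc := tc_const_of_deg_zero (stub_derivDegree (8 + 8) 0 (fun x => decide (Odd (u x))) a hd0) x xA
    have e1 : decide (Odd (u xA)) = false := decide_eq_false ((hmemA xA).1 hxA).1
    have e2 : decide (Odd (u (bxor xA a))) = false := decide_eq_false ((hmemA _).1 hxa).1
    simp only [e1, e2] at hc
    revert hc; cases decide (Odd (u (bxor x a))) <;> cases decide (Odd (u x)) <;> decide
  have hVAmemL : ∀ a ∈ VA, a ∈ VL := fun a ha => mem_filter.2 ⟨mem_univ _, hVAL a ha⟩
  -- on `H`, `d₁` is `V_A`-periodic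
  have hqH : ∀ a ∈ VA, ∀ h, decide (Odd (u h)) = false → decide (Odd (u (bxor h a) / 2)) = decide (Odd (u h / 2)) := by
    intro a ha h hh
    have hha : decide (Odd (u (bxor h a))) = false := by rw [hVAL a ha h]; exact hh
    have key := hperAfun a ha h
    rw [hh, hha] at key
    simpa using key
  obtain ⟨xH, hxH⟩ := heven
  have hxH' : decide (Odd (u xH)) = false := decide_eq_false hxH
  -- two directions in `V_L` transversal to `V_A`
  obtain ⟨t₁, ht₁L, t₂, ht₂L, ht₁, ht₂, -, ht₂₁⟩ := fl1_dirs2 VL VA (by rw [hcardVA, hcardVL]; norm_num)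
  -- the `A`-piece `e = u/2 − 2s`
  set eA : (Fin (8 + 8) → Bool) → ℤ := fun x => u x / 2 - 2 * sZ (f x) with heAdef
  have hFe : ∀ p ∈ A, u p - 4 * sZ (f p) = 2 * eA p := by
    intro p hp
    obtain ⟨k, hk⟩ := Int.not_odd_iff_even.1 ((hmemA p).1 hp).1
    simp only [eA]
    rw [hk, show k + k = 2 * k by ring, Int.mul_ediv_cancel_left k (by norm_num : (2 : ℤ) ≠ 0)]
    ring
  have heA : ∀ p ∈ A, eA p = 1 ∨ eA p = -1 := by
    intro p hp
    have h4 := hτA p hp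
    rw [hFe p hp] at h4
    have h1 : eA p * eA p = 1 := by nlinarith
    exact mul_self_eq_one_iff.1 h1
  have hH_of : ∀ p ∈ A, ∀ t ∈ VL, ¬ Odd (u (bxor p t)) := by
    intro p hp t ht hodd'
    have := hperL t ht p
    rw [decide_eq_false ((hmemA p).1 hp).1] at this
    exact absurd hodd' (by simpa using this)
  have hz : ∀ p ∈ A, ∀ t ∈ VL, t ∉ VA → u (bxor p t) - 4 * sZ (f (bxor p t)) = 0 :=
    fun p hp t ht htA => hτ0 _ (hH_of p hp t ht) (fl1_coset_out h0A haddA hSA hp htA)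
  obtain ⟨H3, H4⟩ := sp_H34 f g hf hg u hu VA A xA h0A haddA hSA eA t₁ t₂ hFe (fun p hp => hz p hp t₁ ht₁L ht₁)
    (fun p hp => hz p hp t₂ ht₂L ht₂) (fun p hp => by
      rw [iw_bxor_assoc]; exact hz p hp _ (haddL _ ht₂L _ ht₁L) ht₂₁)
  have hE := fl1_flat_l1 VA A xA h0A haddA hSA eA heA H3 H4
  set AA : (Fin (8 + 8) → Bool) → ℝ := fun x => if x ∈ A then (eA x : ℝ) else 0 with hAA
  have hYle : ∑ y, |W AA y| ≤ 2 ^ 17 := by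
    have hnn : 0 ≤ ∑ y, |W AA y| := sum_nonneg fun y _ => abs_nonneg _
    norm_num at hE
    nlinarith
  -- the `L`-piece
  set AL : (Fin (8 + 8) → Bool) → ℝ := fun x => if decide (Odd (u x)) = true then signOf (decide (Odd (u x / 2))) else 0 with hAL
  have hL := sp_L_l1 (fun x => decide (Odd (u x))) (fun x => decide (Odd (u x / 2))) hd0 hd1 VA h0A haddA hVAL hqH hxH'
  rw [hcardVA, hfiltL, hL15] at hL
  have hXle : ∑ y, |W AL y| ≤ 2 ^ 17 := by
    have hnn : 0 ≤ ∑ y, |W AL y| := sum_nonneg fun y _ => abs_nonneg _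
    push_cast at hL
    nlinarith
  -- decomposition of the residual
  have hdecomp : (fun x => (u x : ℝ) - 4 * signOf (f x)) = fun x => AL x + 2 * AA x := by
    funext x
    have e : (u x : ℝ) - 4 * signOf (f x) = (((u x - 4 * sZ (f x) : ℤ)) : ℝ) := by push_cast; rw [tp_sZ_cast]
    rw [e]
    by_cases hx : Odd (u x)
    · have hxA' : x ∉ A := fun h => ((hmemA x).1 h).1 hx
      simp only [AL, AA, if_pos (decide_eq_true hx), if_neg hxA']
      rw [hτL x hx, tp_sZ_cast]; ring
    · have hdx : ¬ decide (Odd (u x)) = true := by simpa using hx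
      by_cases hxA' : x ∈ A
      · simp only [AL, AA, if_neg hdx, if_pos hxA']
        rw [hFe x hxA']; push_cast; ring
      · simp only [AL, AA, if_neg hdx, if_neg hxA']
        rw [hτ0 x hx hxA']; norm_num
  -- pairing
  have hpair := sl_pairing16 f g u hu
  rw [hΦ, hdecomp] at hpair
  have e2 : ∀ y, signOf (g y) * W (fun x => AL x + 2 * AA x) y =
      signOf (g y) * W AL y + 2 * (signOf (g y) * W AA y) := fun y => by
    rw [sp_W_add, fl1_W_smul]; ring
  rw [sum_congr rfl fun y _ => e2 y, sum_add_distrib, ← mul_sum] at hpair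
  have hPL : ∑ y, signOf (g y) * W AL y ≤ ∑ y, |W AL y| := fl1_pairing_le_l1 g (W AL)
  have hPA : ∑ y, signOf (g y) * W AA y ≤ ∑ y, |W AA y| := fl1_pairing_le_l1 g (W AA)
  have h26 : (2 : ℝ) ^ 26 * (1 - 31 / 32) = 2 ^ 21 := by norm_num
  rw [h26] at hpair
  linarith

end Summit.QuantumAdvantage.QuantumAdvantage.Theorems.CubicForrelation.NearExactIsExact

end
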